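/-
Copyright (c) 2026 the pub-hodgecm-mathlib formalisation cell (harness21).  Prover seat hodgecm-mathlib-K2E3-p23 (g6), HCML Track B «K2-LIT» ∕ h413
(`stmt-HodgeConjecture-24833`), line `K2_E3_EllipticInputs`, road «GL₂-sc» (road owner K2E5-p17 (g5), dealer K2E3-plan (g4)), NON-ELLIPTIC half, brick 2N-0c,
FILE 3 OF 3: the `Fin 2` twin of ★ B4-1m file 3 `K2E3GL3ModUniformizerVolumeTransfer` (K2E3-p03 (g5)) — VOLUMES AND TRUNCATED CONJUGATION INTEGRALS ON
`G' = GL₂(F) ⧸ ϖ^ℤ·1` READ UPSTAIRS ON THE FUNDAMENTAL DOMAIN `D ⊆ GL₂(F)`.  2026-09-04.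
-/
import Summits.HodgeConjecture.HodgeConjecture.Theorems.K2E3GL2ModUniformizerHaarTransfer     -- ★ 2N-0c F2 (this seat): `isHaarMeasure_map_mk_restrict`, `map_mk_restrict_apply`; brings ★ F1 (`D`, `isCompact_inter_preimage_mk`) and the `G'` frame
import Summits.HodgeConjecture.HodgeConjecture.Theorems.K2E3GL2HeightBallExhaustion           -- ★ 2N-0a p858793 (this seat): `isCompact_image_mk_setOf_adBall`; brings ★ B4-0 file 1 `isOpen_setOf_adBall` (the balls `𝔅_m`)
import Summits.HodgeConjecture.HodgeConjecture.Theorems.K2E3GL3ModUniformizerVolumeTransfer   -- ★ B4-1m F3 (K2E3-p03 g5): the GENERIC §1 (`preimage_mk_setOf_mem_and_conj_mem`, `eq_image_mk_of_forall_mk_mem_iff`, `isOpen_of_forall_mk_mem_iff`, `measurableSet_setOf_mem_and_conj_mem`)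
import Mathlib.MeasureTheory.Integral.Bochner.Set
import HarnessLib

/-!
# Road «GL₂-sc», non-elliptic half, brick 2N-0c (file 3 of 3) — volumes and truncated conjugation integrals on `G' = GL₂(F) ⧸ ϖ^ℤ·1`, read upstairs

Cell `pub/hodgecm-mathlib` (D-0151), Track B «K2-LIT», crux H413 = `stmt-HodgeConjecture-24833`, route of record `HCCMUnconditional`.  Lane
`--supports stmt-HodgeConjecture-24833 --as helper`; THEOREMS ONLY (no `def`, no `instance`, no `notation`, no named-fact hypothesis, no `sorry`); count-neutral.
`Fin 2` reading of ★ B4-1m file 3 (K2E3-p03 (g5), road «GL-[M6]-sc»); its generic §1 (pure group-quotient algebra) is IMPORTED, not restated.  This is the glue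
between the UPSTAIRS volume count of the road (2N-2 VOL-split₂) and the assembly 2N-7 (★ generic `K2E3NonEllEstimatesOfRadius.nonEllEstimates_of_radius`,
hypothesis (hball)) at `G'`.

Frame (verbatim ★ 2N-0c F1): `G' := GL (Fin 2) F ⧸ N'`, `N' := (zpowers (Units.mk0 ϖ hϖ0)).map (scalar (Fin 2))`, window `D := {z | log v(det z) ∈ Icc (−1) 0}`
(clopen fundamental domain, `mk|_D : D ≃ₜ G'`), `μ₁ := (ν.restrict D).map mk` (★ F2: a Haar measure of `G'` for `ν` a Haar measure of `GL₂(F)`).  The exhaustion is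
ABSTRACT: `Ω : ℕ → Set G'`, `B : ℕ → Set (GL (Fin 2) F)`, `hmem : ∀ m g, mk g ∈ Ω m ↔ g ∈ B m` — for the road `B m = 𝔅_m` (★ `K2E3GLnAdHeightBalls`) and `Ω` =
★ 2N-0a `K2E3GL2HeightBallExhaustion.exists_adHeightBall_compactExhaustion_quotScalar`; §4 spells this case out.
* §2 **`exists_eq_smul_map_mk_restrict`** (`∃ c : ℝ≥0, μ' = c • (ν.restrict D).map mk` for ANY Haar `μ'` of `G'`), **`exists_forall_measure_eq_mul_measure_preimage_inter`**.
* §3 **`exists_forall_measure_setOf_mem_and_conj_mem_eq`** — `∃ c, ∀ g R m, μ' {x̄ ∈ Ω R | x̄ · mk g · x̄⁻¹ ∈ Ω m} = c · ν {z | log v(det z) ∈ [−1, 0] ∧ z ∈ B R ∧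
  z g z⁻¹ ∈ B m}`; `lintegral_indicator_comp_conj_eq`; **`setIntegral_norm_comp_conj_le`** (`∫ x̄ in Ω R, ‖θ (x̄ · y · x̄⁻¹)‖ ∂μ' ≤ M · (μ' {…}).toReal`).
* §4 `exists_forall_measure_adBall_conj_eq`, **`setIntegral_norm_comp_conj_le_adBall`** (the road's case `B = 𝔅`, hypothesis-free).
[WeilIntegration1965, §7–§8; Cartier1979, §I.3–I.4; HarishChandra1970, Part VII §3 p. 70]
HONEST LABEL: HC_CM is proved only modulo the 7 printed citations (2 remaining named inputs: hLiu418 = stmt-HodgeConjecture-24832, h413 =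
stmt-HodgeConjecture-24833) until rung 0 closes; count-neutral helper.

## References
* [WeilIntegration1965] A. Weil, *L'intégration dans les groupes topologiques et ses applications*, 2e éd. (1965), §7–§8.
* [Cartier1979] P. Cartier, *Representations of p-adic groups: a survey*, Corvallis (1979), §I.3–I.4.
* [HarishChandra1970] Harish-Chandra (notes by G. van Dijk), *Harmonic Analysis on Reductive p-adic Groups*, LNM 162 (1970), Part VII §3.
-/

set_option autoImplicit false
set_option linter.dupNamespace false   -- `Summit.HodgeConjecture.HodgeConjecture.…` (D-0017 nested layout; lakefile exemption for Summits)

noncomputable section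

open MeasureTheory Measure Topology
open scoped Matrix MatrixGroups WithZero ENNReal NNReal
open Summit.HodgeConjecture.HodgeConjecture.Cruxes.H413.K2E3GL2ModCentre
open Summit.HodgeConjecture.HodgeConjecture.Cruxes.H413.K2E3GL2ModCocompactCentral
open Summit.HodgeConjecture.HodgeConjecture.Cruxes.H413.K2E3GL3ModUniformizerCocompact
open Summit.HodgeConjecture.HodgeConjecture.Cruxes.H413.K2E3GL2ModUniformizerFundamentalDomain
open Summit.HodgeConjecture.HodgeConjecture.Cruxes.H413.K2E3GL2ModUniformizerHaarTransfer
open Summit.HodgeConjecture.HodgeConjecture.Cruxes.H413.K2E3GLnAdHeightBalls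
open Summit.HodgeConjecture.HodgeConjecture.Cruxes.H413.K2E3GL2HeightBallExhaustion
open Summit.HodgeConjecture.HodgeConjecture.Cruxes.H413.K2E3GL3ModUniformizerVolumeTransfer
  (preimage_mk_setOf_mem_and_conj_mem eq_image_mk_of_forall_mk_mem_iff preimage_mk_eq_of_forall_mk_mem_iff isOpen_of_forall_mk_mem_iff
    isClosed_of_forall_mk_mem_iff measurableSet_setOf_mem_and_conj_mem)

namespace Summit.HodgeConjecture.HodgeConjecture.Cruxes.H413.K2E3GL2ModUniformizerVolumeTransfer

/-! ## §2  Haar uniqueness on `G'` -/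

section Transfer

variable {F : Type*} [Field F] [Valued F ℤᵐ⁰] [ValuativeRel F] [(Valued.v : Valuation F ℤᵐ⁰).Compatible] [IsNonarchimedeanLocalField F]
  [MeasurableSpace (GL (Fin 2) F)] [BorelSpace (GL (Fin 2) F)]
  {ϖ : F} (hϖ : Valued.v ϖ = WithZero.exp (-1 : ℤ)) (hϖ0 : ϖ ≠ 0) (ν : Measure (GL (Fin 2) F)) [ν.IsHaarMeasure]
  [((Subgroup.zpowers (Units.mk0 ϖ hϖ0)).map (Matrix.GeneralLinearGroup.scalar (Fin 2))).Normal]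
  [MeasurableSpace (GL (Fin 2) F ⧸ (Subgroup.zpowers (Units.mk0 ϖ hϖ0)).map (Matrix.GeneralLinearGroup.scalar (Fin 2)))]
  [BorelSpace (GL (Fin 2) F ⧸ (Subgroup.zpowers (Units.mk0 ϖ hϖ0)).map (Matrix.GeneralLinearGroup.scalar (Fin 2)))]
  (μ' : Measure (GL (Fin 2) F ⧸ (Subgroup.zpowers (Units.mk0 ϖ hϖ0)).map (Matrix.GeneralLinearGroup.scalar (Fin 2)))) [μ'.IsHaarMeasure]

include hϖ in
/-- **HAAR UNIQUENESS ON `G'`**: every Haar measure `μ'` of `G' = GL₂(F) ⧸ ϖ^ℤ·1` is `c • (ν|_D).map mk` for some `c : ℝ≥0` (★ F2: `(ν|_D).map mk` is a Haar measure;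
`G'` is second countable and locally compact). [cite: WeilIntegration1965, §8; cite: Cartier1979, §I.4] -/
theorem exists_eq_smul_map_mk_restrict :
    ∃ c : ℝ≥0, μ' = c • ((ν.restrict {g : GL (Fin 2) F | WithZero.log (Valued.v (g : Matrix (Fin 2) (Fin 2) F).det) ∈ Set.Icc (-1 : ℤ) 0}).map
      (QuotientGroup.mk : GL (Fin 2) F → GL (Fin 2) F ⧸ (Subgroup.zpowers (Units.mk0 ϖ hϖ0)).map (Matrix.GeneralLinearGroup.scalar (Fin 2)))) := by
  haveI : SecondCountableTopology (GL (Fin 2) F) := secondCountableTopology_gl2 F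
  haveI : LocallyCompactSpace (GL (Fin 2) F) := locallyCompactSpace_gl2 F
  haveI := isHaarMeasure_map_mk_restrict hϖ hϖ0 ν
  exact ⟨_, isMulLeftInvariant_eq_smul μ' _⟩

include hϖ in
/-- **`μ'(A) = c · ν(mk⁻¹ A ∩ D)`** for every measurable `A ⊆ G'`, with ONE constant `c : ℝ≥0` (depending on `μ'`, `ν` only).
[cite: WeilIntegration1965, §7–§8; cite: Cartier1979, §I.3–I.4] -/
theorem exists_forall_measure_eq_mul_measure_preimage_inter :
    ∃ c : ℝ≥0, ∀ A : Set (GL (Fin 2) F ⧸ (Subgroup.zpowers (Units.mk0 ϖ hϖ0)).map (Matrix.GeneralLinearGroup.scalar (Fin 2))), MeasurableSet A →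
      μ' A = c * ν ((QuotientGroup.mk : GL (Fin 2) F → GL (Fin 2) F ⧸ (Subgroup.zpowers (Units.mk0 ϖ hϖ0)).map (Matrix.GeneralLinearGroup.scalar (Fin 2))) ⁻¹' A ∩
        {g : GL (Fin 2) F | WithZero.log (Valued.v (g : Matrix (Fin 2) (Fin 2) F).det) ∈ Set.Icc (-1 : ℤ) 0}) := by
  obtain ⟨c, hc⟩ := exists_eq_smul_map_mk_restrict hϖ hϖ0 ν μ'
  refine ⟨c, fun A hA => ?_⟩
  rw [hc, Measure.smul_apply, map_mk_restrict_apply hϖ0 ν hA, ENNReal.smul_def, smul_eq_mul]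

/-! ## §3  The brick: volumes of conjugation-membership sets of `G'`, read upstairs on `D` -/

include hϖ in
/-- **VOL-TRANSFER.**  For an abstract exhaustion `Ω : ℕ → Set G'` with membership law `mk z ∈ Ω n ↔ z ∈ B n` (`B n ⊆ GL₂(F)` open — for the road `B n = 𝔅_n`,
★ B4-0), ANY Haar measure `μ'` of `G'` and a Haar measure `ν` of `GL₂(F)`: there is ONE `c : ℝ≥0` with, for all `g : GL₂(F)` and `R m : ℕ`,
`μ' {x̄ | x̄ ∈ Ω R ∧ x̄ · mk g · x̄⁻¹ ∈ Ω m} = c · ν {z | log v(det z) ∈ [−1, 0] ∧ z ∈ B R ∧ z g z⁻¹ ∈ B m}`.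
[cite: WeilIntegration1965, §7–§8; cite: HarishChandra1970, Part VII §3 p. 70] -/
theorem exists_forall_measure_setOf_mem_and_conj_mem_eq
    (Ω : ℕ → Set (GL (Fin 2) F ⧸ (Subgroup.zpowers (Units.mk0 ϖ hϖ0)).map (Matrix.GeneralLinearGroup.scalar (Fin 2)))) (B : ℕ → Set (GL (Fin 2) F))
    (hmem : ∀ (n : ℕ) (z : GL (Fin 2) F),
      (QuotientGroup.mk z : GL (Fin 2) F ⧸ (Subgroup.zpowers (Units.mk0 ϖ hϖ0)).map (Matrix.GeneralLinearGroup.scalar (Fin 2))) ∈ Ω n ↔ z ∈ B n)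
    (hB : ∀ n, IsOpen (B n)) :
    ∃ c : ℝ≥0, ∀ (g : GL (Fin 2) F) (R m : ℕ),
      μ' {x | x ∈ Ω R ∧ x * QuotientGroup.mk g * x⁻¹ ∈ Ω m} =
        c * ν {z : GL (Fin 2) F | WithZero.log (Valued.v (z : Matrix (Fin 2) (Fin 2) F).det) ∈ Set.Icc (-1 : ℤ) 0 ∧ z ∈ B R ∧ z * g * z⁻¹ ∈ B m} := by
  obtain ⟨c, hc⟩ := exists_forall_measure_eq_mul_measure_preimage_inter hϖ hϖ0 ν μ'
  refine ⟨c, fun g R m => ?_⟩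
  have hΩ : ∀ n, MeasurableSet (Ω n) := fun n => (isOpen_of_forall_mk_mem_iff _ Ω B hmem (hB n)).measurableSet
  rw [hc _ (measurableSet_setOf_mem_and_conj_mem _ (hΩ R) (hΩ m) _), preimage_mk_setOf_mem_and_conj_mem _ Ω B hmem g R m]
  congr 2
  ext z
  simp only [Set.mem_inter_iff, Set.mem_setOf_eq]
  tauto

omit [ValuativeRel F] [(Valued.v : Valuation F ℤᵐ⁰).Compatible] [IsNonarchimedeanLocalField F] [MeasurableSpace (GL (Fin 2) F)] [BorelSpace (GL (Fin 2) F)]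
  [ν.IsHaarMeasure] [μ'.IsHaarMeasure] in
/-- **The `lintegral` form**: `∫⁻ x̄ in Ω R, 𝟙_{Ω m}(x̄ · y · x̄⁻¹) ∂μ' = μ' {x̄ | x̄ ∈ Ω R ∧ x̄ · y · x̄⁻¹ ∈ Ω m}` for measurable `Ω m`.
[cite: HarishChandra1970, Part VII §3 p. 70] -/
theorem lintegral_indicator_comp_conj_eq
    (Ω : ℕ → Set (GL (Fin 2) F ⧸ (Subgroup.zpowers (Units.mk0 ϖ hϖ0)).map (Matrix.GeneralLinearGroup.scalar (Fin 2)))) {m : ℕ} (hΩm : MeasurableSet (Ω m))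
    (y : GL (Fin 2) F ⧸ (Subgroup.zpowers (Units.mk0 ϖ hϖ0)).map (Matrix.GeneralLinearGroup.scalar (Fin 2))) (R : ℕ) :
    ∫⁻ x in Ω R, (Ω m).indicator (1 : GL (Fin 2) F ⧸ (Subgroup.zpowers (Units.mk0 ϖ hϖ0)).map (Matrix.GeneralLinearGroup.scalar (Fin 2)) → ℝ≥0∞) (x * y * x⁻¹) ∂μ' =
      μ' {x | x ∈ Ω R ∧ x * y * x⁻¹ ∈ Ω m} := by
  have hc : Measurable fun x : GL (Fin 2) F ⧸ (Subgroup.zpowers (Units.mk0 ϖ hϖ0)).map (Matrix.GeneralLinearGroup.scalar (Fin 2)) => x * y * x⁻¹ :=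
    ((continuous_id.mul continuous_const).mul continuous_id.inv).measurable
  have hS : MeasurableSet {x : GL (Fin 2) F ⧸ (Subgroup.zpowers (Units.mk0 ϖ hϖ0)).map (Matrix.GeneralLinearGroup.scalar (Fin 2)) | x * y * x⁻¹ ∈ Ω m} :=
    hc hΩm
  have hfun : (fun x : GL (Fin 2) F ⧸ (Subgroup.zpowers (Units.mk0 ϖ hϖ0)).map (Matrix.GeneralLinearGroup.scalar (Fin 2)) =>
      (Ω m).indicator (1 : GL (Fin 2) F ⧸ (Subgroup.zpowers (Units.mk0 ϖ hϖ0)).map (Matrix.GeneralLinearGroup.scalar (Fin 2)) → ℝ≥0∞) (x * y * x⁻¹)) =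
        {x : GL (Fin 2) F ⧸ (Subgroup.zpowers (Units.mk0 ϖ hϖ0)).map (Matrix.GeneralLinearGroup.scalar (Fin 2)) | x * y * x⁻¹ ∈ Ω m}.indicator 1 := by
    funext x
    by_cases hx : x * y * x⁻¹ ∈ Ω m
    · rw [Set.indicator_of_mem hx, Set.indicator_of_mem (show x ∈ {x | x * y * x⁻¹ ∈ Ω m} from hx), Pi.one_apply, Pi.one_apply]
    · rw [Set.indicator_of_notMem hx, Set.indicator_of_notMem (show x ∉ {x | x * y * x⁻¹ ∈ Ω m} from hx)]
  rw [hfun, lintegral_indicator_one hS, Measure.restrict_apply hS]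
  congr 1
  ext x
  simp only [Set.mem_inter_iff, Set.mem_setOf_eq]
  tauto

omit [ValuativeRel F] [(Valued.v : Valuation F ℤᵐ⁰).Compatible] [IsNonarchimedeanLocalField F] [MeasurableSpace (GL (Fin 2) F)] [BorelSpace (GL (Fin 2) F)]
  [ν.IsHaarMeasure] [μ'.IsHaarMeasure] in
/-- **The Bochner form (what ASM's (hball) eats)**: for `θ : G' → E` bounded by `M`, vanishing off `Ω m`, and `Ω R` measurable of finite `μ'`-measure,
`∫ x̄ in Ω R, ‖θ (x̄ · y · x̄⁻¹)‖ ∂μ' ≤ M · (μ' {x̄ | x̄ ∈ Ω R ∧ x̄ · y · x̄⁻¹ ∈ Ω m}).toReal`. [cite: HarishChandra1970, Part VII §3 p. 70] -/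
theorem setIntegral_norm_comp_conj_le {E : Type*} [NormedAddCommGroup E]
    (Ω : ℕ → Set (GL (Fin 2) F ⧸ (Subgroup.zpowers (Units.mk0 ϖ hϖ0)).map (Matrix.GeneralLinearGroup.scalar (Fin 2)))) {R m : ℕ}
    (hΩR : MeasurableSet (Ω R)) (hfin : μ' (Ω R) < ∞)
    (θ : GL (Fin 2) F ⧸ (Subgroup.zpowers (Units.mk0 ϖ hϖ0)).map (Matrix.GeneralLinearGroup.scalar (Fin 2)) → E) {M : ℝ} (hM : ∀ x, ‖θ x‖ ≤ M)
    (hsupp : ∀ x, x ∉ Ω m → θ x = 0) (y : GL (Fin 2) F ⧸ (Subgroup.zpowers (Units.mk0 ϖ hϖ0)).map (Matrix.GeneralLinearGroup.scalar (Fin 2))) :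
    ∫ x in Ω R, ‖θ (x * y * x⁻¹)‖ ∂μ' ≤ M * (μ' {x | x ∈ Ω R ∧ x * y * x⁻¹ ∈ Ω m}).toReal := by
  have hc : Measurable fun x : GL (Fin 2) F ⧸ (Subgroup.zpowers (Units.mk0 ϖ hϖ0)).map (Matrix.GeneralLinearGroup.scalar (Fin 2)) => x * y * x⁻¹ :=
    ((continuous_id.mul continuous_const).mul continuous_id.inv).measurable
  set S : Set (GL (Fin 2) F ⧸ (Subgroup.zpowers (Units.mk0 ϖ hϖ0)).map (Matrix.GeneralLinearGroup.scalar (Fin 2))) :=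
    {x | x ∈ Ω R ∧ x * y * x⁻¹ ∈ Ω m} with hSdef
  have hSsub : S ⊆ Ω R := fun x hx => hx.1
  have hSfin : μ' S < ∞ := (measure_mono hSsub).trans_lt hfin
  -- the integrand vanishes on `Ω R ∖ S`
  have hzero : ∀ x ∈ Ω R \ S, ‖θ (x * y * x⁻¹)‖ = 0 := by
    intro x hx
    have hx' : x * y * x⁻¹ ∉ Ω m := fun h => hx.2 ⟨hx.1, h⟩
    rw [hsupp _ hx', norm_zero]
  rw [setIntegral_eq_of_subset_of_forall_sdiff_eq_zero hΩR hSsub hzero]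
  have hle := norm_setIntegral_le_of_norm_le_const (f := fun x => ‖θ (x * y * x⁻¹)‖) hSfin (C := M) fun x _ => by
    rw [norm_norm]; exact hM _
  rw [measureReal_def] at hle
  exact (Real.le_norm_self _).trans hle

/-! ## §4  The road's case: the Ad-height balls `B = 𝔅`, `Ω = mk(𝔅)` (★ B4-0) -/

include hϖ in
/-- **VOL-TRANSFER FOR THE AD-HEIGHT EXHAUSTION** (`𝔅_n(g) :≡ ∀ i j k l, |ϖ^n g_{ij} (g⁻¹)_{kl}| ≤ 1`, `mk g ∈ Ω n ↔ 𝔅_n(g)` — conjunct (i) of ★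
`exists_adHeightBall_compactExhaustion_quotScalar`): for ANY Haar measure `μ'` of `G'` there is ONE `c : ℝ≥0` with, for all `g, R, m`,
`μ' {x̄ ∈ Ω R | x̄ · mk g · x̄⁻¹ ∈ Ω m} = c · ν {z | log v(det z) ∈ [−1, 0] ∧ 𝔅_R(z) ∧ 𝔅_m(z g z⁻¹)}`.
[cite: HarishChandra1970, Part VII §3 p. 70; cite: WeilIntegration1965, §7–§8] -/
theorem exists_forall_measure_adBall_conj_eq
    (Ω : ℕ → Set (GL (Fin 2) F ⧸ (Subgroup.zpowers (Units.mk0 ϖ hϖ0)).map (Matrix.GeneralLinearGroup.scalar (Fin 2))))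
    (hmem : ∀ (n : ℕ) (z : GL (Fin 2) F),
      (QuotientGroup.mk z : GL (Fin 2) F ⧸ (Subgroup.zpowers (Units.mk0 ϖ hϖ0)).map (Matrix.GeneralLinearGroup.scalar (Fin 2))) ∈ Ω n ↔
        ∀ i j k l, Valued.v (ϖ ^ n * ((z : Matrix (Fin 2) (Fin 2) F) i j * ((z⁻¹ : GL (Fin 2) F) : Matrix (Fin 2) (Fin 2) F) k l)) ≤ 1) :
    ∃ c : ℝ≥0, ∀ (g : GL (Fin 2) F) (R m : ℕ),
      μ' {x | x ∈ Ω R ∧ x * QuotientGroup.mk g * x⁻¹ ∈ Ω m} =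
        c * ν {z : GL (Fin 2) F | WithZero.log (Valued.v (z : Matrix (Fin 2) (Fin 2) F).det) ∈ Set.Icc (-1 : ℤ) 0 ∧
          (∀ i j k l, Valued.v (ϖ ^ R * ((z : Matrix (Fin 2) (Fin 2) F) i j * ((z⁻¹ : GL (Fin 2) F) : Matrix (Fin 2) (Fin 2) F) k l)) ≤ 1) ∧
          ∀ i j k l, Valued.v (ϖ ^ m * (((z * g * z⁻¹ : GL (Fin 2) F) : Matrix (Fin 2) (Fin 2) F) i j *
            (((z * g * z⁻¹)⁻¹ : GL (Fin 2) F) : Matrix (Fin 2) (Fin 2) F) k l)) ≤ 1} :=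
  exists_forall_measure_setOf_mem_and_conj_mem_eq hϖ hϖ0 ν μ' Ω
    (fun n => {z : GL (Fin 2) F | ∀ i j k l, Valued.v (ϖ ^ n * ((z : Matrix (Fin 2) (Fin 2) F) i j * ((z⁻¹ : GL (Fin 2) F) : Matrix (Fin 2) (Fin 2) F) k l)) ≤ 1})
    hmem fun n => isOpen_setOf_adBall ϖ n

include hϖ in
/-- **The Bochner form for the Ad-height exhaustion, hypothesis-free**: `Ω R = mk(𝔅_R)` is clopen and COMPACT (★ B4-0 `isCompact_image_mk_setOf_adBall`, ★ B0z
`F^× ⧸ ϖ^ℤ` compact), so for `θ` bounded by `M` and vanishing off `Ω m`: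
`∫ x̄ in Ω R, ‖θ (x̄ · mk g · x̄⁻¹)‖ ∂μ' ≤ M · (c · ν {z | log v(det z) ∈ [−1, 0] ∧ 𝔅_R(z) ∧ 𝔅_m(z g z⁻¹)}).toReal` with the constant `c` of
`exists_forall_measure_adBall_conj_eq`. [cite: HarishChandra1970, Part VII §3 p. 70] -/
theorem setIntegral_norm_comp_conj_le_adBall {E : Type*} [NormedAddCommGroup E]
    (Ω : ℕ → Set (GL (Fin 2) F ⧸ (Subgroup.zpowers (Units.mk0 ϖ hϖ0)).map (Matrix.GeneralLinearGroup.scalar (Fin 2))))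
    (hmem : ∀ (n : ℕ) (z : GL (Fin 2) F),
      (QuotientGroup.mk z : GL (Fin 2) F ⧸ (Subgroup.zpowers (Units.mk0 ϖ hϖ0)).map (Matrix.GeneralLinearGroup.scalar (Fin 2))) ∈ Ω n ↔
        ∀ i j k l, Valued.v (ϖ ^ n * ((z : Matrix (Fin 2) (Fin 2) F) i j * ((z⁻¹ : GL (Fin 2) F) : Matrix (Fin 2) (Fin 2) F) k l)) ≤ 1) :
    ∃ c : ℝ≥0, ∀ (θ : GL (Fin 2) F ⧸ (Subgroup.zpowers (Units.mk0 ϖ hϖ0)).map (Matrix.GeneralLinearGroup.scalar (Fin 2)) → E) (M : ℝ) (m : ℕ),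
      (∀ x, ‖θ x‖ ≤ M) → (∀ x, x ∉ Ω m → θ x = 0) → ∀ (g : GL (Fin 2) F) (R : ℕ),
        ∫ x in Ω R, ‖θ (x * QuotientGroup.mk g * x⁻¹)‖ ∂μ' ≤
          M * (c * ν {z : GL (Fin 2) F | WithZero.log (Valued.v (z : Matrix (Fin 2) (Fin 2) F).det) ∈ Set.Icc (-1 : ℤ) 0 ∧
            (∀ i j k l, Valued.v (ϖ ^ R * ((z : Matrix (Fin 2) (Fin 2) F) i j * ((z⁻¹ : GL (Fin 2) F) : Matrix (Fin 2) (Fin 2) F) k l)) ≤ 1) ∧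
            ∀ i j k l, Valued.v (ϖ ^ m * (((z * g * z⁻¹ : GL (Fin 2) F) : Matrix (Fin 2) (Fin 2) F) i j *
              (((z * g * z⁻¹)⁻¹ : GL (Fin 2) F) : Matrix (Fin 2) (Fin 2) F) k l)) ≤ 1}).toReal := by
  obtain ⟨c, hc⟩ := exists_forall_measure_adBall_conj_eq hϖ hϖ0 ν μ' Ω hmem
  refine ⟨c, fun θ M m hM hsupp g R => ?_⟩
  -- `Ω n = mk '' 𝔅_n` is open (measurable) and compact
  have heq : ∀ n, Ω n = (QuotientGroup.mk : GL (Fin 2) F → GL (Fin 2) F ⧸ (Subgroup.zpowers (Units.mk0 ϖ hϖ0)).map (Matrix.GeneralLinearGroup.scalar (Fin 2))) ''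
      {z : GL (Fin 2) F | ∀ i j k l, Valued.v (ϖ ^ n * ((z : Matrix (Fin 2) (Fin 2) F) i j * ((z⁻¹ : GL (Fin 2) F) : Matrix (Fin 2) (Fin 2) F) k l)) ≤ 1} :=
    fun n => eq_image_mk_of_forall_mk_mem_iff _ Ω _ hmem n
  have hΩ : ∀ n, MeasurableSet (Ω n) := fun n => by
    rw [heq n]
    exact (isOpen_image_mk_setOf_adBall _ ϖ n).measurableSet
  haveI : CompactSpace (Fˣ ⧸ Subgroup.zpowers (Units.mk0 ϖ hϖ0)) := compactSpace_units_quot_zpowers_uniformizer hϖ hϖ0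
  have hcpt : IsCompact (Ω R) := by
    rw [heq R]
    exact isCompact_image_mk_setOf_adBall _ hϖ R
  rw [← hc g R m]
  exact setIntegral_norm_comp_conj_le hϖ0 μ' Ω (hΩ R) hcpt.measure_lt_top θ hM hsupp _

end Transfer

end Summit.HodgeConjecture.HodgeConjecture.Cruxes.H413.K2E3GL2ModUniformizerVolumeTransfer

end
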